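import Summits.NavierStokesRegularity.NavierStokesRegularity.Theorems.SoloRefuteAtarka2026
import Mathlib.MeasureTheory.Measure.Haar.NormedSpace
import HarnessLib

/-!
# Solo refutation companion (D-0090 NS-CLAIMS, C128): Atarka, HAL hal-05563207 v1 (2026) — Step 2,
# Lemme 3.4 (9), by concentration

Cell `ns-claims`. Kit by **ns-claims-typist-12 g2** (`claims/Atarka2026/killkit-lemma34-typist12.lean`, sha16
2c443873ff47586f), adopted by the refuter of record ns-claims-refuter-7 g0 as the second sibling of
`SoloRefuteAtarka2026.lean` (Step 1 kill = locator of record), which it IMPORTS for `ballΩ` / `isAdmissibleDomain_ball`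
(originally typist-12 g2's lemmas, landed there); changes w.r.t. the kit: that import, the four ball declarations removed,
docstrings added. Witness and proofs: ns-claims-typist-12 g2. Main theorems: `not_Lemma34C : ¬ Lemma34C` and
`not_Lemma34 : ¬ Lemma34` (std axioms).

Lemme 3.4 (9) [PDF p.4 l.43–55] «Pour tout u ∈ H²(Ω), ‖(u·∇)u‖_{L²} ≤ C_L‖u‖_{H¹}‖u‖_{H²}^{1/2}‖u‖_{L²}^{1/2}»
fails on the unit ball for EVERY constant, by concentration: `w_λ(x) = W(λx)` with `W(x) = θ(x) x₀ e₀`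
(`θ` a smooth bump, `≡ 1` on `B(0,1/4)`, supported in `B(0,1/2)`), `λ → ∞`: `‖(w_λ·∇)w_λ‖² = λ⁻¹N`,
`‖w_λ‖² = λ⁻³A`, `‖∇w_λ‖² = λ⁻¹G`, `Σ‖∂ᵢ∂ⱼw_λ‖² = λH`, so the right side of (9)⁴ is `O(λ⁻⁴)` against `λ⁻²N²`.

WHAT THIS IS NOT: not a statement about the Navier–Stokes problem itself; not about any author beyond the typed
locator.
-/

noncomputable section

open Set Function Filter MeasureTheory TopologicalSpace Metric
open scoped Topology ENNReal ContDiff InnerProductSpace RealInnerProductSpace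

-- lint debt (cell convention, SoloRefute files): the Theorems namespace repeats `NavierStokesRegularity`.
set_option linter.dupNamespace false

namespace Summit.NavierStokesRegularity.NavierStokesRegularity.Theorems.Atarka2026

open Literature.Claims.NS.Atarka2026 Literature.Analysis.FluidPDE

/-! ### The profile `W` and its concentrates -/

/-- A smooth bump on `ℝ³`: `≡ 1` on `B(0,1/4)`, supported in `B(0,1/2)`. -/
def θ : ContDiffBump (0 : E3) := ⟨1 / 4, 1 / 2, by norm_num, by norm_num⟩

/-- Inner radius of the bump `θ`. -/
theorem θ_rIn : θ.rIn = 1 / 4 := rfl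

/-- Outer radius of the bump `θ`. -/
theorem θ_rOut : θ.rOut = 1 / 2 := rfl

/-- The profile `W(x) = θ(x) x₀ e₀`. -/
def W (x : E3) : E3 := (θ x * x 0) • e 0

/-- `W` is smooth. -/
theorem contDiff_W : ContDiff ℝ ∞ W :=
  (θ.contDiff.mul (EuclideanSpace.proj (𝕜 := ℝ) (0 : Fin 3)).contDiff).smul contDiff_const

/-- `W` vanishes outside the open ball of radius `1/2`. -/
theorem W_eq_zero_of_norm {x : E3} (hx : 1 / 2 ≤ ‖x‖) : W x = 0 := by
  have : θ x = 0 := by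
    rw [← Function.notMem_support, θ.support_eq, mem_ball, dist_zero_right, θ_rOut, not_lt]
    exact hx
  simp [W, this]

/-- The topological support of `W` lies in the closed ball of radius `1/2`. -/
theorem tsupport_W_subset : tsupport W ⊆ closedBall (0 : E3) (1 / 2) := by
  refine closure_minimal (fun x hx => ?_) isClosed_closedBall
  rw [mem_closedBall, dist_zero_right]
  by_contra h
  exact hx (W_eq_zero_of_norm (le_of_lt (not_le.mp h)))

/-- `W` has compact support. -/
theorem hasCompactSupport_W : HasCompactSupport W :=
  HasCompactSupport.of_support_subset_isCompact (isCompact_closedBall (0 : E3) (1 / 2))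
    (subset_tsupport W |>.trans tsupport_W_subset)

/-- Off the closed ball of radius `1/2`, `W` vanishes identically near the point. -/
theorem W_eventuallyEq_zero {x : E3} (hx : 1 / 2 < ‖x‖) : W =ᶠ[𝓝 x] fun _ => 0 := by
  have hopen : IsOpen {y : E3 | 1 / 2 < ‖y‖} := isOpen_lt continuous_const continuous_norm
  filter_upwards [hopen.mem_nhds hx] with y hy
  exact W_eq_zero_of_norm (le_of_lt hy)

/-- Near the origin (`‖x‖ < 1/4`), `W` is the linear field `x ↦ x₀ e₀`. -/
theorem W_eventuallyEq_lin {x : E3} (hx : ‖x‖ < 1 / 4) :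
    W =ᶠ[𝓝 x] fun y => ((EuclideanSpace.proj (𝕜 := ℝ) (0 : Fin 3)).smulRight (e 0)) y := by
  have hopen : IsOpen (ball (0 : E3) (1 / 4)) := isOpen_ball
  filter_upwards [hopen.mem_nhds (by simpa [mem_ball, dist_zero_right] using hx)] with y hy
  have hθ : θ y = 1 := θ.one_of_mem_closedBall (ball_subset_closedBall (by rwa [θ_rIn]))
  simp [W, hθ, ContinuousLinearMap.smulRight_apply]


/-! ### Scaling lemmas -/

/-- `W` is differentiable. -/
theorem differentiable_W : Differentiable ℝ W := contDiff_W.differentiable (by simp)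

/-- `∂ⱼW` as a function. -/
def pdW (j : Fin 3) (z : E3) : E3 := fderiv ℝ W z (e j)

/-- The partial derivatives `∂ⱼW` are smooth. -/
theorem contDiff_pdW (j : Fin 3) : ContDiff ℝ ∞ (pdW j) :=
  (contDiff_W.fderiv_right (m := ∞) (by simp)).clm_apply contDiff_const

/-- The partial derivatives `∂ⱼW` are differentiable. -/
theorem differentiable_pdW (j : Fin 3) : Differentiable ℝ (pdW j) := (contDiff_pdW j).differentiable (by simp)

/-- Chain rule for a dilation. -/
theorem hasFDerivAt_comp_smul {F : Type*} [NormedAddCommGroup F] [NormedSpace ℝ F] {f : E3 → F}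
    {lam : ℝ} {x : E3} (hf : DifferentiableAt ℝ f (lam • x)) :
    HasFDerivAt (fun y => f (lam • y)) (lam • fderiv ℝ f (lam • x)) x := by
  have h1 : HasFDerivAt (fun y : E3 => lam • y) (lam • ContinuousLinearMap.id ℝ E3) x :=
    (hasFDerivAt_id x).const_smul lam
  have h2 : HasFDerivAt (fun y => f (lam • y)) ((fderiv ℝ f (lam • x)).comp (lam • ContinuousLinearMap.id ℝ E3)) x :=
    hf.hasFDerivAt.comp x h1
  refine h2.congr_fderiv ?_
  ext v
  simp

/-- `fderiv` of a dilation `y ↦ f (λ y)`. -/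
theorem fderiv_comp_smul {F : Type*} [NormedAddCommGroup F] [NormedSpace ℝ F] {f : E3 → F}
    {lam : ℝ} {x : E3} (hf : DifferentiableAt ℝ f (lam • x)) :
    fderiv ℝ (fun y => f (lam • y)) x = lam • fderiv ℝ f (lam • x) :=
  (hasFDerivAt_comp_smul hf).fderiv

/-- The concentrates `w_λ(x) = W(λx)`. -/
def wL (lam : ℝ) (x : E3) : E3 := W (lam • x)

/-- The concentrates `w_λ` are smooth. -/
theorem contDiff_wL (lam : ℝ) : ContDiff ℝ ∞ (wL lam) :=
  contDiff_W.comp (contDiff_id.const_smul lam)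

/-- `D w_λ(x) = λ · DW(λx)`. -/
theorem fderiv_wL (lam : ℝ) (x : E3) : fderiv ℝ (wL lam) x = lam • fderiv ℝ W (lam • x) :=
  fderiv_comp_smul (differentiable_W _)

/-- `(w_λ·∇)w_λ(x) = λ · (W·∇)W(λx)`. -/
theorem convect_wL (lam : ℝ) (x : E3) : convect (wL lam) (wL lam) x = lam • convect W W (lam • x) := by
  rw [convect, convect, fderiv_wL]; rfl

/-- `∂ⱼ w_λ = λ · (∂ⱼW)(λ ·)`. -/
theorem pd_wL (lam : ℝ) (j : Fin 3) :
    (fun y => fderiv ℝ (wL lam) y (e j)) = fun y => lam • pdW j (lam • y) := by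
  funext y
  rw [fderiv_wL]; rfl

/-- Second derivatives of the concentrate: `∂ᵢ∂ⱼ w_λ(x) = λ² · ∂ᵢ∂ⱼW(λx)`. -/
theorem hess_wL (lam : ℝ) (i j : Fin 3) (x : E3) :
    fderiv ℝ (fun y => fderiv ℝ (wL lam) y (e j)) x (e i) = (lam * lam) • fderiv ℝ (pdW j) (lam • x) (e i) := by
  have h : HasFDerivAt (fun y => lam • pdW j (lam • y)) (lam • (lam • fderiv ℝ (pdW j) (lam • x))) x :=
    (hasFDerivAt_comp_smul (differentiable_pdW j (lam • x))).const_smul lam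
  rw [pd_wL, h.fderiv]
  simp [smul_smul]

/-- `‖c L‖_F² = c² ‖L‖_F²`. -/
theorem frobeniusNormSq_smul (c : ℝ) (L : E3 →L[ℝ] E3) :
    frobeniusNormSq (c • L) = c ^ 2 * frobeniusNormSq L := by
  simp [frobeniusNormSq, norm_smul, mul_pow, Finset.mul_sum]

/-- Change of variables `x ↦ λx` in `ℝ³`. -/
theorem integral_comp_smul_E3 (f : E3 → ℝ) {lam : ℝ} (hlam : 0 < lam) :
    ∫ x, f (lam • x) = (lam ^ 3)⁻¹ * ∫ x, f x := by
  rw [Measure.integral_comp_smul (volume : Measure E3) f lam, finrank_euclideanSpace, Fintype.card_fin,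
    smul_eq_mul, abs_of_pos (by positivity)]

/-! ### Vanishing off the ball at scale `λ ≥ 1` -/

/-- For `λ ≥ 1`, points outside the unit ball are dilated outside `B(0,1/2)`. -/
theorem norm_smul_gt {lam : ℝ} (hlam : 1 ≤ lam) {x : E3} (hx : x ∉ (ballΩ : Set E3)) : 1 / 2 < ‖lam • x‖ := by
  rw [coe_ballΩ, mem_ball, dist_zero_right, not_lt] at hx
  rw [norm_smul, Real.norm_of_nonneg (by linarith)]
  nlinarith

/-- `DW = 0` outside the closed ball of radius `1/2`. -/
theorem fderiv_W_eq_zero {z : E3} (hz : 1 / 2 < ‖z‖) : fderiv ℝ W z = 0 := by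
  rw [(W_eventuallyEq_zero hz).fderiv_eq]; simp

/-- `D(∂ⱼW) = 0` outside the closed ball of radius `1/2`. -/
theorem fderiv_pdW_eq_zero {z : E3} (hz : 1 / 2 < ‖z‖) (j : Fin 3) : fderiv ℝ (pdW j) z = 0 := by
  have h : pdW j =ᶠ[𝓝 z] fun _ => 0 := by
    filter_upwards [(W_eventuallyEq_zero hz).fderiv (𝕜 := ℝ)] with y hy
    simp [pdW, hy]
  rw [h.fderiv_eq]; simp

/-! ### The four norms of the concentrates -/

/-- `A = ‖W‖²`, `G = ‖∇W‖²`, `Hs = Σ‖∂ᵢ∂ⱼW‖²`, `N = ‖(W·∇)W‖²` (whole-space integrals). -/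
def cA : ℝ := ∫ z, ‖W z‖ ^ 2
/-- `G = ∫ ‖DW‖_F²`. -/
def cG : ℝ := ∫ z, frobeniusNormSq (fderiv ℝ W z)
/-- `H = ∫ Σᵢⱼ ‖∂ᵢ∂ⱼW‖²`. -/
def cH : ℝ := ∫ z, ∑ i, ∑ j, ‖fderiv ℝ (pdW j) z (e i)‖ ^ 2
/-- `N = ∫ ‖(W·∇)W‖²`. -/
def cN : ℝ := ∫ z, ‖convect W W z‖ ^ 2

/-- Scaling of the `L²` mass: `‖w_λ‖² = λ⁻³ A`. -/
theorem l2Sq_wL {lam : ℝ} (hlam : 1 ≤ lam) : l2Sq ballΩ (wL lam) = (lam ^ 3)⁻¹ * cA := by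
  unfold l2Sq cA
  rw [setIntegral_eq_integral_of_forall_compl_eq_zero fun x hx => by
    simp [wL, W_eq_zero_of_norm (le_of_lt (norm_smul_gt hlam hx))]]
  exact integral_comp_smul_E3 (fun z => ‖W z‖ ^ 2) (by linarith)

/-- Scaling of the gradient mass: `‖∇w_λ‖² = λ² · λ⁻³ G`. -/
theorem gradSq_wL {lam : ℝ} (hlam : 1 ≤ lam) : gradSq ballΩ (wL lam) = lam ^ 2 * ((lam ^ 3)⁻¹ * cG) := by
  unfold gradSq cG
  simp_rw [fderiv_wL, frobeniusNormSq_smul]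
  rw [setIntegral_eq_integral_of_forall_compl_eq_zero fun x hx => by
    simp [fderiv_W_eq_zero (norm_smul_gt hlam hx), frobeniusNormSq], integral_const_mul]
  rw [integral_comp_smul_E3 (fun z => frobeniusNormSq (fderiv ℝ W z)) (by linarith)]

/-- Scaling of the Hessian mass: `Σ‖∂ᵢ∂ⱼw_λ‖² = λ⁴ · λ⁻³ H`. -/
theorem hessSq_wL {lam : ℝ} (hlam : 1 ≤ lam) : hessSq ballΩ (wL lam) = lam ^ 4 * ((lam ^ 3)⁻¹ * cH) := by
  unfold hessSq cH
  simp_rw [hess_wL, norm_smul, mul_pow, ← Finset.mul_sum]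
  rw [setIntegral_eq_integral_of_forall_compl_eq_zero fun x hx => by
    simp [fderiv_pdW_eq_zero (norm_smul_gt hlam hx)], integral_const_mul,
    integral_comp_smul_E3 (fun z => ∑ i, ∑ j, ‖fderiv ℝ (pdW j) z (e i)‖ ^ 2) (by linarith)]
  congr 1
  rw [Real.norm_of_nonneg (by nlinarith)]
  ring

/-- Scaling of the convective mass: `‖(w_λ·∇)w_λ‖² = λ² · λ⁻³ N`. -/
theorem convectSq_wL {lam : ℝ} (hlam : 1 ≤ lam) :
    ∫ x in (ballΩ : Set E3), ‖convect (wL lam) (wL lam) x‖ ^ 2 = lam ^ 2 * ((lam ^ 3)⁻¹ * cN) := by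
  unfold cN
  simp_rw [convect_wL, norm_smul, mul_pow]
  rw [setIntegral_eq_integral_of_forall_compl_eq_zero fun x hx => by
    simp [convect, fderiv_W_eq_zero (norm_smul_gt hlam hx)], integral_const_mul,
    integral_comp_smul_E3 (fun z => ‖convect W W z‖ ^ 2) (by linarith)]
  congr 1
  rw [Real.norm_of_nonneg (by linarith)]

/-- `A ≥ 0`. -/
theorem cA_nonneg : 0 ≤ cA := integral_nonneg fun _ => by positivity
/-- `G ≥ 0`. -/
theorem cG_nonneg : 0 ≤ cG := integral_nonneg fun _ => by unfold frobeniusNormSq; positivity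
/-- `H ≥ 0`. -/
theorem cH_nonneg : 0 ≤ cH := integral_nonneg fun _ => by positivity

/-! ### `N > 0`: the convective term of `W` does not vanish at `x₀ = e₀/8` -/

/-- The point `x₀ = e₀/8`. -/
def x₀ : E3 := (1 / 8 : ℝ) • e 0

/-- `‖e₀‖ = 1`. -/
theorem norm_e0 : ‖(e 0 : E3)‖ = 1 := by simp [e]

/-- `‖x₀‖ = 1/8`. -/
theorem norm_x₀ : ‖x₀‖ = 1 / 8 := by
  rw [x₀, norm_smul, norm_e0, Real.norm_of_nonneg (by norm_num), mul_one]

/-- At `x₀ = e₀/8` (inside the flat core of the bump) `(W·∇)W = e₀/8 ≠ 0`. -/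
theorem convect_W_x₀ : convect W W x₀ = (1 / 8 : ℝ) • e 0 := by
  have hW : W x₀ = (1 / 8 : ℝ) • e 0 := by
    have hθ : θ x₀ = 1 := θ.one_of_mem_closedBall (by
      rw [mem_closedBall, dist_zero_right, norm_x₀, θ_rIn]; norm_num)
    have hx00 : x₀ 0 = 1 / 8 := by simp [x₀, e]
    rw [W, hθ, hx00, one_mul]
  have hfd : fderiv ℝ W x₀ = (EuclideanSpace.proj (𝕜 := ℝ) (0 : Fin 3)).smulRight (e 0) := by
    rw [(W_eventuallyEq_lin (by rw [norm_x₀]; norm_num)).fderiv_eq, ContinuousLinearMap.fderiv]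
  rw [convect, hfd, hW]
  simp [e]

/-- `N > 0`: the convective term of `W` is not identically zero (continuity at `x₀`). -/
theorem cN_pos : 0 < cN := by
  have hcont : Continuous fun z => ‖convect W W z‖ ^ 2 :=
    (((contDiff_W.continuous_fderiv (by simp)).clm_apply contDiff_W.continuous).norm).pow 2
  have hsupp : HasCompactSupport fun z => ‖convect W W z‖ ^ 2 := by
    refine HasCompactSupport.of_support_subset_isCompact (isCompact_closedBall (0 : E3) (1 / 2)) ?_
    intro z hz
    rw [mem_closedBall, dist_zero_right]
    by_contra h
    apply hz
    simp [convect, fderiv_W_eq_zero (not_le.mp h)]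
  unfold cN
  rw [integral_pos_iff_support_of_nonneg (fun z => by positivity) (hcont.integrable_of_hasCompactSupport hsupp)]
  refine (hcont.isOpen_support).measure_pos volume ⟨x₀, ?_⟩
  rw [Function.mem_support, convect_W_x₀, norm_smul, norm_e0, Real.norm_of_nonneg (by norm_num)]
  norm_num

/-! ### The kill -/

set_option maxHeartbeats 400000 in
/-- **Kill of Step 2 (constant-free shape)** — Lemme 3.4 (9), PDF p.4 l.43–55, on the unit ball: for every
constant `C`, the concentrate `w_λ = W(λ·)` with `λ = 1 + C⁴K/N²` (`K = (A+G)²(A+G+H)A`) violates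
`‖(w·∇)w‖ ≤ C‖w‖_{H¹}‖w‖_{H²}^{1/2}‖w‖_{L²}^{1/2}`. [claim: Atarka2026, status: disputed]
WHAT THIS IS NOT: not a claim about NS regularity or blow-up; not a claim about any author beyond the typed
locator. -/
theorem not_Lemma34C : ¬ Literature.Claims.NS.Atarka2026.Lemma34C := by
  intro h
  obtain ⟨C, hC⟩ := h ballΩ isAdmissibleDomain_ball
  set K : ℝ := (cA + cG) ^ 2 * (cA + cG + cH) * cA with hK
  have hK0 : 0 ≤ K := by have := cA_nonneg; have := cG_nonneg; have := cH_nonneg; positivity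
  have hN := cN_pos
  set lam : ℝ := 1 + C ^ 4 * K / cN ^ 2 with hlam
  have hlam1 : 1 ≤ lam := by
    have : 0 ≤ C ^ 4 * K / cN ^ 2 := by positivity
    linarith
  have hlam0 : 0 < lam := by linarith
  have key := hC (wL lam) (contDiff_wL lam)
  simp only [convectL2, h1Norm, h2Norm, l2Norm, convectSq_wL hlam1, l2Sq_wL hlam1, gradSq_wL hlam1,
    hessSq_wL hlam1] at key
  -- pass to `u = λ⁻¹ ∈ (0,1]`, `u λ = 1`
  simp only [← inv_pow] at key
  set u : ℝ := lam⁻¹ with hu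
  have hu0 : 0 < u := by rw [hu]; positivity
  have hu1 : u ≤ 1 := by rw [hu]; exact inv_le_one_of_one_le₀ hlam1
  have hul : u * lam = 1 := by rw [hu]; field_simp
  have e1 : lam ^ 2 * (u ^ 3 * cN) = u * cN := by
    calc lam ^ 2 * (u ^ 3 * cN) = u * cN * (u * lam) ^ 2 := by ring
      _ = u * cN := by rw [hul]; ring
  have e2 : lam ^ 2 * (u ^ 3 * cG) = u * cG := by
    calc lam ^ 2 * (u ^ 3 * cG) = u * cG * (u * lam) ^ 2 := by ring
      _ = u * cG := by rw [hul]; ring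
  have e3 : lam ^ 4 * (u ^ 3 * cH) = lam * cH := by
    calc lam ^ 4 * (u ^ 3 * cH) = lam * cH * (u * lam) ^ 3 := by ring
      _ = lam * cH := by rw [hul]; ring
  rw [e1, e2, e3] at key
  set X : ℝ := u * cN with hX
  set a : ℝ := u ^ 3 * cA + u * cG with ha
  set b : ℝ := u ^ 3 * cA + u * cG + lam * cH with hb
  set c : ℝ := u ^ 3 * cA with hc
  have hA := cA_nonneg; have hG := cG_nonneg; have hH := cH_nonneg
  have hX0 : 0 < X := by positivity
  have ha0 : 0 ≤ a := by positivity
  have hb0 : 0 ≤ b := by positivity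
  have hc0 : 0 ≤ c := by positivity
  -- key : √X ≤ C * √a * √(√b) * √(√c)
  have hR0 : 0 ≤ Real.sqrt a * Real.sqrt (Real.sqrt b) * Real.sqrt (Real.sqrt c) := by positivity
  rcases le_or_gt C 0 with hCle | hCpos
  · have h1 : C * Real.sqrt a * Real.sqrt (Real.sqrt b) * Real.sqrt (Real.sqrt c) ≤ 0 := by
      have : C * (Real.sqrt a * Real.sqrt (Real.sqrt b) * Real.sqrt (Real.sqrt c)) ≤ 0 :=
        mul_nonpos_of_nonpos_of_nonneg hCle hR0
      linarith [this]
    have h2 : 0 < Real.sqrt X := Real.sqrt_pos.2 hX0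
    linarith
  · -- square twice: X² ≤ C⁴ a² b c
    have h1 : X ≤ (C * Real.sqrt a * Real.sqrt (Real.sqrt b) * Real.sqrt (Real.sqrt c)) ^ 2 :=
      (Real.sqrt_le_left (by positivity)).1 key
    have h2 : (C * Real.sqrt a * Real.sqrt (Real.sqrt b) * Real.sqrt (Real.sqrt c)) ^ 2
        = C ^ 2 * a * Real.sqrt b * Real.sqrt c := by
      rw [mul_pow, mul_pow, mul_pow, Real.sq_sqrt ha0, Real.sq_sqrt (Real.sqrt_nonneg _),
        Real.sq_sqrt (Real.sqrt_nonneg _)]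
    rw [h2] at h1
    have h3 : X ^ 2 ≤ (C ^ 2 * a * Real.sqrt b * Real.sqrt c) ^ 2 := pow_le_pow_left₀ hX0.le h1 2
    have h4 : (C ^ 2 * a * Real.sqrt b * Real.sqrt c) ^ 2 = C ^ 4 * (a ^ 2 * b * c) := by
      rw [mul_pow, mul_pow, mul_pow, Real.sq_sqrt hb0, Real.sq_sqrt hc0]; ring
    rw [h4] at h3
    -- bounds: a ≤ u(A+G), b ≤ λ(A+G+H), c = u³A  ⇒  a²bc ≤ u⁴K
    have hu3 : u ^ 3 ≤ u := by
      have := pow_le_pow_of_le_one hu0.le hu1 (show 1 ≤ 3 by norm_num)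
      simpa using this
    have hul1 : u ≤ lam := hu1.trans hlam1
    have haB : a ≤ u * (cA + cG) := by
      have : u ^ 3 * cA ≤ u * cA := mul_le_mul_of_nonneg_right hu3 hA
      rw [ha]; linarith
    have hbB : b ≤ lam * (cA + cG + cH) := by
      have h1' : u ^ 3 * cA ≤ lam * cA := mul_le_mul_of_nonneg_right (hu3.trans hul1) hA
      have h2' : u * cG ≤ lam * cG := mul_le_mul_of_nonneg_right hul1 hG
      rw [hb]; linarith
    have h5 : a ^ 2 * b * c ≤ (u * (cA + cG)) ^ 2 * (lam * (cA + cG + cH)) * (u ^ 3 * cA) := by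
      gcongr
    have h6 : (u * (cA + cG)) ^ 2 * (lam * (cA + cG + cH)) * (u ^ 3 * cA) = u ^ 4 * K := by
      calc (u * (cA + cG)) ^ 2 * (lam * (cA + cG + cH)) * (u ^ 3 * cA) = u ^ 4 * K * (u * lam) := by
            rw [hK]; ring
        _ = u ^ 4 * K := by rw [hul, mul_one]
    rw [h6] at h5
    -- X² = u²N² ≤ C⁴u⁴K ⇒ N² ≤ C⁴Ku² ≤ C⁴Ku
    have h7 : u ^ 2 * cN ^ 2 ≤ u ^ 2 * (C ^ 4 * K * u ^ 2) := by
      have e4 : X ^ 2 = u ^ 2 * cN ^ 2 := by rw [hX]; ring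
      have h5' : C ^ 4 * (a ^ 2 * b * c) ≤ C ^ 4 * (u ^ 4 * K) :=
        mul_le_mul_of_nonneg_left h5 (by positivity)
      calc u ^ 2 * cN ^ 2 = X ^ 2 := e4.symm
        _ ≤ C ^ 4 * (u ^ 4 * K) := h3.trans h5'
        _ = u ^ 2 * (C ^ 4 * K * u ^ 2) := by ring
    have h8 : cN ^ 2 ≤ C ^ 4 * K * u ^ 2 := le_of_mul_le_mul_left h7 (pow_pos hu0 2)
    have h9 : cN ^ 2 ≤ C ^ 4 * K * u := by
      have hu2 : u ^ 2 ≤ u := by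
        have := mul_le_mul_of_nonneg_left hu1 hu0.le
        simpa [sq] using this
      have hCK : 0 ≤ C ^ 4 * K := mul_nonneg (by positivity) hK0
      exact h8.trans (mul_le_mul_of_nonneg_left hu2 hCK)
    -- multiply by λ: λN² ≤ C⁴K, but λN² = N² + C⁴K
    have h10 : lam * cN ^ 2 ≤ C ^ 4 * K := by
      have := mul_le_mul_of_nonneg_left h9 hlam0.le
      calc lam * cN ^ 2 ≤ lam * (C ^ 4 * K * u) := this
        _ = C ^ 4 * K * (u * lam) := by ring
        _ = C ^ 4 * K := by rw [hul, mul_one]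
    have h11 : lam * cN ^ 2 = cN ^ 2 + C ^ 4 * K := by
      rw [hlam, add_mul, one_mul, div_mul_cancel₀ _ (pow_ne_zero 2 hN.ne')]
    have : 0 < cN ^ 2 := pow_pos hN 2
    linarith

/-- **Kill of Step 2 as printed** (with `C_L = C_S^{3/2}λ₁^{-1/2}`): immediate from the constant-free kill via
`lemma34C_of_lemma34`. [claim: Atarka2026, status: disputed] -/
theorem not_Lemma34 : ¬ Literature.Claims.NS.Atarka2026.Lemma34 :=
  fun h => not_Lemma34C (lemma34C_of_lemma34 h)

end Summit.NavierStokesRegularity.NavierStokesRegularity.Theorems.Atarka2026
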